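import Summits.CriticalPhenomena.CardyFormulaZ2.Theses.ModulusResponse
import Summits.CriticalPhenomena.CardyFormulaZ2.Theorems.ModulusResponseSmirnovCellAnchorLimit
import Summits.CriticalPhenomena.CardyFormulaZ2.Theorems.ModulusResponseSmirnovCellAnchorSandwichMarked
import Summits.CriticalPhenomena.CardyFormulaZ2.Theorems.ModulusResponseSmirnovCellAnchorSandwichPaths
import Literature.Probability.Percolation.ZdNearCriticalWindow
import Literature.Probability.RandomPlanarGeometry.ChordalCurveFamily
import Mathlib.Analysis.SpecialFunctions.Trigonometric.DerivHyp

/-!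
# `SmirnovCellAnchor`: Smirnov's theorem at `u = 0` in the `ℤ²` frame (route ModulusResponse, support item)

Closes `Summit.CriticalPhenomena.CardyFormulaZ2.Theses.ModulusResponse.SmirnovCellAnchor`
(stmt-CriticalPhenomena-6471): for the cell family `μ_u` and the diagonal stretches
`S_t z = cosh t z + i sinh t z̄` (both pinned by their defining equations), at `u = 0` the G02 bond
crossing probability of the stretched conformal rectangle `S_{t₀}(R)`, `t₀ = -(log 3)/4`, converges
to Cardy's function of the cross-ratio of `R` as the mesh `δ → 0⁺`, for every conformal rectangle
`R` and every uniformizing datum.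

Proof. (1) `μ_0` is the law of the one-layer cell configuration `Φ X` (left and down edges of the
sites of `X`), `X ∼ P^{site}_{1/2}` (`…CellLaw`). (2) The frame change `g(x+iy) = x + yζ` makes the
cell clusters the site clusters of `𝕋` and `g ∘ S_{t₀}` is the complex similarity `z ↦ a z`,
`a = cosh t₀ + sinh t₀ ζ` (`cosh t₀ = -(2+√3) sinh t₀`), so `W = g(S_{t₀} R) = a R` is a conformal
rectangle with the same cross-ratios. (3) In the frame of `W` the cell crossing probability is
sandwiched, up to corner terms, by the open crossing probabilities of the marked discrete domains of
Bollobás–Riordan's Lemma 14 (`…SandwichPaths`, `…SandwichMarked`, from the `ℤ²` stubs of the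
oracle-sandwich line and the path conversions of `…CellPaths`), for `W` when its Carleson triangle is
anticlockwise and for `W.conjugate` otherwise (lattice reflection). (4) The tree's proof of
Smirnov's theorem (Bollobás–Riordan 2006, Ch. 7) run with this middle term gives the limit
`|d - c|/|a - c|` of a Carleson datum (`…Approx`, `…Limit`), which is `F(η)` by the Cardy–Carleson
identity (`cardyFunction_crossRatio_eq_carlesonRatio_holds`).
-/

noncomputable section

namespace Summit.CriticalPhenomena.CardyFormulaZ2.Theorems.SmirnovCellAnchor

open Set Metric Filter Topology MeasureTheory Complex
open Literature.Probability.LatticeModels Literature.Probability.RandomPlanarGeometry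
  Literature.Probability.Percolation
open scoped ComplexConjugate

/-! ### The anchor constant and the frame similarity -/

/-- **The anchor constant**: at `t₀ = -(log 3)/4` one has `cosh t₀ = -(2 + √3) sinh t₀`
(equivalently `e^{2t₀} = 1/√3`). [folklore] -/
theorem cosh_anchor : Real.cosh (-(Real.log 3) / 4) = -(2 + Real.sqrt 3) * Real.sinh (-(Real.log 3) / 4) := by
  set τ : ℝ := -(Real.log 3) / 4 with hτ
  set u : ℝ := Real.exp τ with hu
  have hu0 : 0 < u := Real.exp_pos τ
  have hw : (u ^ 2) ^ 2 = 1 / 3 := by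
    rw [← pow_mul, hu, ← Real.exp_nat_mul]
    norm_num [hτ]
    rw [show (4 : ℝ) * (-Real.log 3 / 4) = -Real.log 3 by ring, Real.exp_neg, Real.exp_log (by norm_num), one_div]
  have h3 : Real.sqrt 3 * Real.sqrt 3 = 3 := Real.mul_self_sqrt (by norm_num)
  have hkey : (3 + Real.sqrt 3) * u ^ 2 = 1 + Real.sqrt 3 := by
    have h1 : ((3 + Real.sqrt 3) * u ^ 2) ^ 2 = (1 + Real.sqrt 3) ^ 2 := by
      rw [mul_pow, hw]; nlinarith [h3]
    exact (sq_eq_sq₀ (by positivity) (by positivity)).1 h1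
  rw [Real.cosh_eq, Real.sinh_eq, ← hu, Real.exp_neg, ← hu]
  field_simp
  nlinarith [hkey, h3, hu0]

/-- The companion identity `sinh t₀ = (√3 - 2) cosh t₀`. [folklore] -/
theorem sinh_anchor : Real.sinh (-(Real.log 3) / 4) = (Real.sqrt 3 - 2) * Real.cosh (-(Real.log 3) / 4) := by
  have h3 : Real.sqrt 3 * Real.sqrt 3 = 3 := Real.mul_self_sqrt (by norm_num)
  have e1 := cosh_anchor
  linear_combination (-(Real.sqrt 3 - 2)) * e1 + Real.sinh (-(Real.log 3) / 4) * h3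

/-- **The frame change composed with the anchor stretch is a complex similarity**:
`g (S_{t₀} z) = a z` with `a = cosh t₀ + sinh t₀ ζ` (the matrix `GᵀG` has eigenvalues `3/2`, `1/2`
on the diagonals, which `S_{t₀}` compensates). [folklore] -/
theorem frame_stretch_eq_mul (S : ℝ → ℂ → ℂ)
    (hS : ∀ t z, S t z = (Real.cosh t : ℂ) * z + Complex.I * (Real.sinh t : ℂ) * (starRingEnd ℂ) z)
    (g : ℂ → ℂ) (hg : ∀ z, g z = (z.re : ℂ) + (z.im : ℂ) * triZeta) (z : ℂ) :
    g (S (-(Real.log 3) / 4) z) =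
      ((Real.cosh (-(Real.log 3) / 4) : ℂ) + (Real.sinh (-(Real.log 3) / 4) : ℂ) * triZeta) * z := by
  have e1 := cosh_anchor
  have e2 := sinh_anchor
  rw [hg, hS]
  apply Complex.ext
  · simp only [add_re, mul_re, ofReal_re, ofReal_im, zero_mul, sub_zero, I_re, I_im, mul_im, conj_re, conj_im,
      triZeta_re, triZeta_im, add_im, zero_add]
    linear_combination (z.im / 2) * e1
  · simp only [add_im, mul_im, ofReal_re, ofReal_im, zero_mul, add_zero, I_re, I_im, mul_re, conj_re, conj_im,
      triZeta_re, triZeta_im, add_re, zero_add, sub_zero]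
    linear_combination (-(z.im / 2)) * e2

/-- The similarity ratio `a = cosh t₀ + sinh t₀ ζ` is nonzero. [folklore] -/
theorem anchor_ne_zero :
    ((Real.cosh (-(Real.log 3) / 4) : ℂ) + (Real.sinh (-(Real.log 3) / 4) : ℂ) * triZeta) ≠ 0 := by
  intro h
  have him := congrArg Complex.im h
  simp only [add_im, ofReal_im, mul_im, ofReal_re, triZeta_im, triZeta_re, zero_add, zero_im, zero_mul, add_zero] at him
  have hs0 : 0 < Real.sqrt 3 := Real.sqrt_pos.2 (by norm_num)
  have hsh : Real.sinh (-(Real.log 3) / 4) ≠ 0 := by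
    rw [Ne, Real.sinh_eq_zero]
    have := Real.log_pos (by norm_num : (1 : ℝ) < 3)
    intro h0; linarith
  apply hsh
  nlinarith [him, hs0]

/-- Carleson's ratio is invariant under complex conjugation of the datum. [folklore] -/
theorem carlesonRatio_conj (a c d : ℂ) :
    carlesonRatio (conj a) (conj c) (conj d) = carlesonRatio a c d := by
  unfold carlesonRatio
  rw [← map_sub, ← map_sub, Complex.norm_conj, Complex.norm_conj]

/-! ### The core: the cell crossing probability of `Q` tends to Carleson's ratio of `W = g(Q)` -/

/-- **The cell crossing probability converges to Carleson's ratio** of any Carleson datum of the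
`𝕋`-frame rectangle `W = g(Q)`: anticlockwise data directly (`tendsto_cell_of_sandwich` with the
direct sandwich), clockwise data through the conjugate rectangle (reflected sandwich).
[cite: BollobasRiordan2006, Ch. 7 Thm. 2 (p. 165, proof pp. 202–203)] -/
theorem tendsto_cell_carleson (Φ : Set (Site 2) → BondConfig (Site 2))
    (hΦ : ∀ X, Φ X = {e | ∃ m ∈ X, e = s(m - Pi.single 0 1, m) ∨ e = s(m - Pi.single 1 1, m)})
    (g : ℂ → ℂ) (hg : ∀ z, g z = (z.re : ℂ) + (z.im : ℂ) * triZeta)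
    (Q W : ConformalRectangle) (hW : W.carrier = g '' Q.carrier)
    (hWarc : ∀ i, W.arc i = g '' Q.arc i) (hWpt : ∀ j, W.pt j = g (Q.pt j))
    {a b c d : ℂ} (ψ : ConformalEquiv W.carrier (openTriangle a b c)) (habc : IsEquilateral a b c)
    (hd : d ∈ openSegment ℝ c a) (hψ : IsCarlesonMap W a b c d ψ) :
    Tendsto (fun δ => (triSitePercolation half).real
        {ω | Φ ω ∈ discreteCrossing Q.carrier δ (Q.arc 0) (Q.arc 2)}) (𝓝[>] 0) (𝓝 (carlesonRatio a c d)) := by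
  set cell : ℝ → ℝ := fun δ => (triSitePercolation half).real
    {ω | Φ ω ∈ discreteCrossing Q.carrier δ (Q.arc 0) (Q.arc 2)} with hcell
  rcases triangleTurn_eq_or_of_isEquilateral habc with hacw | hcw
  · exact tendsto_cell_of_sandwich W a b c d ψ habc hd hψ (hacw.trans triOmega_eq.symm) cell
      (fun ρ hρ => openCrossingProb_le_cell_add Φ Q W (real_pathIn_le_cell Φ hΦ g hg Q W hW hWarc hWpt hρ))
      (fun ρ hρ => cell_le_openCrossingProb_add Φ Q W (cell_le_real_not_pathIn Φ hΦ g hg Q W hW hWarc hWpt hρ))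
  · -- clockwise: pass to the conjugate rectangle
    set W' : ConformalRectangle := W.conjugate with hW'
    set ψ' : ConformalEquiv W'.carrier (openTriangle (conj a) (conj b) (conj c)) :=
      (ψ.conjugate W.isOpen (isOpen_openTriangle a b c)).trans (ConformalEquiv.ofEq (conjSet_openTriangle a b c)) with hψ'
    have habc' := habc.conj
    have hd' := mem_openSegment_conj hd
    have hbv : ∀ (i : Fin 4) (w : ℂ), ψ.HasBoundaryValue (W.pt i) w → ψ'.HasBoundaryValue (W'.pt i) (conj w) := by
      intro i w hw
      exact ConformalEquiv.HasBoundaryValue.conjugate W.isOpen (isOpen_openTriangle a b c) hw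
    have hψ'C : IsCarlesonMap W' (conj a) (conj b) (conj c) (conj d) ψ' :=
      ⟨hbv 0 a hψ.1, hbv 1 b hψ.2.1, hbv 2 c hψ.2.2.1, hbv 3 d hψ.2.2.2⟩
    have hacw' : triangleTurn (conj a) (conj b) (conj c) = triOmega := by
      rw [triangleTurn_conj, hcw, Complex.conj_conj, triOmega_eq]
    rw [← carlesonRatio_conj]
    exact tendsto_cell_of_sandwich W' _ _ _ _ ψ' habc' hd' hψ'C hacw' cell
      (fun ρ hρ => openCrossingProb_le_cell_add Φ Q W' (real_pathIn_le_cell_conj Φ hΦ g hg Q W hW hWarc hWpt hρ))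
      (fun ρ hρ => cell_le_openCrossingProb_add Φ Q W' (cell_le_real_not_pathIn_conj Φ hΦ g hg Q W hW hWarc hWpt hρ))

end Summit.CriticalPhenomena.CardyFormulaZ2.Theorems.SmirnovCellAnchor

/-! ### The route item -/

namespace Summit.CriticalPhenomena.CardyFormulaZ2.Theorems

open Set Metric Filter Topology MeasureTheory Complex
open Literature.Probability.LatticeModels Literature.Probability.RandomPlanarGeometry
  Literature.Probability.Percolation SmirnovCellAnchor
open scoped ComplexConjugate

/-- **`SmirnovCellAnchor` holds** — Smirnov's theorem at the solved point `u = 0` of the self-dual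
cell segment, in the `ℤ²` frame: `μ_0[cross S_{t₀}(R)] → F(η(R))` for every conformal rectangle `R`,
`t₀ = -(log 3)/4` (see the module docstring for the proof).
[cite: Smirnov2001, Thm. 1] [cite: BollobasRiordan2006, Ch. 7 Thm. 2 and Lemma 14] -/
theorem smirnovCellAnchor_proof :
    Summit.CriticalPhenomena.CardyFormulaZ2.Theses.ModulusResponse.SmirnovCellAnchor := by
  intro μ S hμ hS R φ x hφx
  classical
  set τ : ℝ := -(Real.log 3) / 4 with hτ
  -- the stretch as a plane homeomorphism, and the `ℤ²`-frame rectangle `Q = S_τ R`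
  have hcomp : ∀ s t z, S s (S t z) = S (s + t) z := by
    intro s t z
    rw [hS, hS, hS, Real.cosh_add, Real.sinh_add]
    simp only [map_add, map_mul, Complex.conj_ofReal, Complex.conj_I, Complex.conj_conj]
    push_cast
    ring_nf
    rw [Complex.I_sq]
    ring
  have hS0 : ∀ z, S 0 z = z := fun z => by rw [hS]; simp
  have hScont : ∀ t, Continuous (S t) := fun t => by
    have : S t = fun z => (Real.cosh t : ℂ) * z + Complex.I * (Real.sinh t : ℂ) * (starRingEnd ℂ) z := funext (hS t)
    rw [this]; fun_prop
  let Th : ℂ ≃ₜ ℂ :=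
    { toFun := S τ
      invFun := S (-τ)
      left_inv := fun z => by show S (-τ) (S τ z) = z; rw [hcomp, neg_add_cancel, hS0]
      right_inv := fun z => by show S τ (S (-τ) z) = z; rw [hcomp, add_neg_cancel, hS0]
      continuous_toFun := hScont τ
      continuous_invFun := hScont (-τ) }
  have hTh : (Th : ℂ → ℂ) = S τ := rfl
  set Q : ConformalRectangle := R.map Th with hQ
  have hQc : Q.carrier = S τ '' R.carrier := rfl
  have hQarc : ∀ i, Q.arc i = S τ '' R.arc i := fun i => by rw [hQ, MarkedDomain.arc_map]; rfl
  have hQpt : ∀ j, Q.pt j = S τ (R.pt j) := fun j => rfl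
  -- the `𝕋` frame: `W = g(Q) = a R`
  set g : ℂ → ℂ := fun z => (z.re : ℂ) + (z.im : ℂ) * triZeta with hg
  have hg' : ∀ z, g z = (z.re : ℂ) + (z.im : ℂ) * triZeta := fun z => rfl
  set a : ℂ := (Real.cosh τ : ℂ) + (Real.sinh τ : ℂ) * triZeta with ha
  have ha0 : a ≠ 0 := anchor_ne_zero
  have hgS : ∀ z, g (S τ z) = a * z := frame_stretch_eq_mul S hS g hg'
  have hgS' : ∀ A : Set ℂ, g '' (S τ '' A) = (similarity a ha0 0) '' A := fun A => by
    rw [image_image]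
    refine image_congr fun z _ => ?_
    rw [hgS, similarity_apply, add_zero]
  set W : ConformalRectangle := R.map (similarity a ha0 0) with hWdef
  have hW : W.carrier = g '' Q.carrier := by rw [hQc, hgS']; rfl
  have hWarc : ∀ i, W.arc i = g '' Q.arc i := fun i => by rw [hQarc, hgS', hWdef, MarkedDomain.arc_map]
  have hWpt : ∀ j, W.pt j = g (Q.pt j) := fun j => by
    rw [hQpt, hgS, hWdef, MarkedDomain.pt_map, similarity_apply, add_zero]
  -- a uniformizing datum of `W` with the same real points
  set φW : ConformalEquiv UpperHalfPlane.upperHalfPlaneSet W.carrier :=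
    φ.trans (ChordalFamily.similarityConformalEquiv a ha0 0 R.carrier) with hφW
  have hφW' : W.IsUniformizing φW x := by
    refine ⟨hφx.1, fun i => ?_⟩
    have h1 := hφx.2 i
    have h2 : Tendsto (similarity a ha0 0) (𝓝 (R.pt i)) (𝓝 (similarity a ha0 0 (R.pt i))) :=
      (similarity a ha0 0).continuous.continuousAt
    show Tendsto ((similarity a ha0 0) ∘ φ) (𝓝[UpperHalfPlane.upperHalfPlaneSet] (x i : ℂ))
      (𝓝 (similarity a ha0 0 (R.pt i)))
    exact h2.comp h1
  -- Cardy = Carleson for `W`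
  obtain ⟨a', b', c', d', ψ', habc', hd', hψ'⟩ := exists_isCarlesonMap_holds W
  have hC := cardyFunction_crossRatio_eq_carlesonRatio_holds W a' b' c' d' ψ' φW x habc' hd' hψ' hφW'
  rw [hC]
  -- `μ_0` probabilities are cell probabilities
  have hlaw : ∀ δ, (μ 0).real (discreteCrossing (S τ '' R.carrier) δ (S τ '' R.arc 0) (S τ '' R.arc 2)) =
      (triSitePercolation half).real {ω | ({e | ∃ m ∈ ω, e = s(m - Pi.single 0 1, m) ∨ e = s(m - Pi.single 1 1, m)} :
        BondConfig (Site 2)) ∈ discreteCrossing Q.carrier δ (Q.arc 0) (Q.arc 2)} := fun δ => by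
    rw [hQarc, hQarc, hQc]
    exact measureReal_zero_apply μ hμ (measurableSet_discreteCrossing _ _ _ _)
  simp_rw [hlaw]
  exact tendsto_cell_carleson (fun ω => {e | ∃ m ∈ ω, e = s(m - Pi.single 0 1, m) ∨ e = s(m - Pi.single 1 1, m)})
    (fun _ => rfl) g hg' Q W hW hWarc hWpt ψ' habc' hd' hψ'

end Summit.CriticalPhenomena.CardyFormulaZ2.Theorems

end
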